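import Summits.QuantumFields.YangMills.Theses.LangevinControlUV
import Summits.QuantumFields.YangMills.Theorems.ContinuumLimitOnTrajectory.Negative.UltralocalZeroCoupling

/-!
# `FemtoCurvatureSkewness` — negative-side support I: vocabulary; `β = 0` is an exact zero; level structure

Support file 1/3 for crux `stmt-QuantumFields-9365` (`LangevinControlUV.FemtoCurvatureSkewness`, rank 4), extracted from
the standing disprover's work file `Cruxes/FemtoCurvatureSkewness/Disproof.lean` §§1–3 (cdisprove gen 1).  Tree objects
only (`wilsonExpectation`, `plaquetteHolonomy`, `haarProbability`, the `ContinuumLimitOnTrajectory.Negative` Haar toolkit);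
nothing is posited, no `sorry`.

* Vocabulary `plaq`, `wE`, `wCov`, `kappa3`, `torusDist`, `TwoPointPackage`, `SkewnessPackage`: the crux is (definitionally,
  `Iff.rfl` in the work file's `crux_iff`, not restated here) `∀ G simple, ∀ r a, TwoPointPackage r a → SkewnessPackage r a`
  (`kappa3` = the typed third cumulant of `(P_0^{01}, P_{ne₂}^{01}, P_{ne₃}^{01})`).
* `integral_mul_plaquette_of_private`, `kappa3_zero_coupling`: under product Haar (`β = 0`) the plaquette at `n e₃`
  owns a private bond, so the crux's cumulant vanishes EXACTLY on every torus (`L ≥ 2`, `n ≢ 0 mod L`), for every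
  compact `G` and every `LatticeRep` — the threshold `β₁` is load-bearing;
  `not_skewnessBoundAllCouplings`: the natural strengthening "lower bound at all couplings and all volumes" is false.
* `skewnessPackage_iff_levelwise`: the conclusion depends on the unit map `a` only through the level sets
  `n·a(β) = s` (Γ₃ is free); `eventually_kappa3_ne_zero`: for EVERY unit map (`a > 0`, `a → 0`) the skewness
  package forces fixed-torus eventual non-vanishing `∀ L ≥ 8n, ∀ᶠ β → ∞, κ₃(L,β,n) ≠ 0`;
  `zero_of_sign_change`: IVT form of the only kill mechanism (an admissible exact zero of `β ↦ κ₃`; continuity is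
  proved in support file III).
-/

noncomputable section

namespace Summit.QuantumFields.YangMills.Theorems.FemtoCurvatureSkewness.Negative

open MeasureTheory Filter Topology
open Literature.MathematicalPhysics.QuantumFieldTheory
open Summit.QuantumFields.YangMills.Theorems.ContinuumLimitOnTrajectory.Negative

/-! ## §1 Vocabulary: the crux, unbundled -/

section Vocabulary

variable {G : Type} [Group G] [TopologicalSpace G] [IsTopologicalGroup G] [CompactSpace G]
  [MeasurableSpace G] [BorelSpace G]

/-- The plaquette action variable `P_x^{ij}(U) = N − Re tr r(U_{x,ij})` of the crux. -/
def plaq (r : LatticeRep G) (L : ℕ) (x : Site 4 L) (i j : Fin 4) (U : GaugeConfig 4 L G) : ℝ :=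
  (r.N : ℝ) - (r.ρ (plaquetteHolonomy U x i j)).trace.re

/-- Wilson expectation on the torus `(ℤ/L)⁴` at coupling `β` (tree normalisation `e^{-β Σ_p P_p}`). -/
def wE (r : LatticeRep G) (L : ℕ) [NeZero L] (β : ℝ) (F : GaugeConfig 4 L G → ℝ) : ℝ :=
  wilsonExpectation (d := 4) (L := L) r.ρ β F

/-- Covariance under the torus Wilson measure. -/
def wCov (r : LatticeRep G) (L : ℕ) [NeZero L] (β : ℝ) (F F' : GaugeConfig 4 L G → ℝ) : ℝ :=
  wE r L β (fun U => F U * F' U) - wE r L β F * wE r L β F'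

/-- **The crux's third cumulant** `κ₃(P_0^{01}, P_{ne₂}^{01}, P_{ne₃}^{01})` on `(ℤ/L)⁴` at coupling `β`,
written exactly as in the route file (`E[XYZ] − E X·Cov(Y,Z) − E Y·Cov(X,Z) − E Z·Cov(X,Y) − E X E Y E Z`). -/
def kappa3 (r : LatticeRep G) (L : ℕ) [NeZero L] (β : ℝ) (n : ℕ) : ℝ :=
  wE r L β (fun U => plaq r L 0 0 1 U * plaq r L (Pi.single (2 : Fin 4) ((n : ℕ) : ZMod L)) 0 1 U *
      plaq r L (Pi.single (3 : Fin 4) ((n : ℕ) : ZMod L)) 0 1 U)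
    - wE r L β (plaq r L 0 0 1) *
        wCov r L β (plaq r L (Pi.single (2 : Fin 4) ((n : ℕ) : ZMod L)) 0 1)
          (plaq r L (Pi.single (3 : Fin 4) ((n : ℕ) : ZMod L)) 0 1)
    - wE r L β (plaq r L (Pi.single (2 : Fin 4) ((n : ℕ) : ZMod L)) 0 1) *
        wCov r L β (plaq r L 0 0 1) (plaq r L (Pi.single (3 : Fin 4) ((n : ℕ) : ZMod L)) 0 1)
    - wE r L β (plaq r L (Pi.single (3 : Fin 4) ((n : ℕ) : ZMod L)) 0 1) *
        wCov r L β (plaq r L 0 0 1) (plaq r L (Pi.single (2 : Fin 4) ((n : ℕ) : ZMod L)) 0 1)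
    - wE r L β (plaq r L 0 0 1) * wE r L β (plaq r L (Pi.single (2 : Fin 4) ((n : ℕ) : ZMod L)) 0 1) *
        wE r L β (plaq r L (Pi.single (3 : Fin 4) ((n : ℕ) : ZMod L)) 0 1)

/-- Euclidean torus distance used by the all-pairs clause. -/
def torusDist (L : ℕ) (x y : Site 4 L) : ℝ :=
  Real.sqrt (∑ k : Fin 4, (((x k - y k).valMinAbs : ℤ) : ℝ) ^ 2)

/-- **Hypothesis of the crux**: the two-point package of `FemtoCurvatureTwoPoint` for the unit map `a`. -/
def TwoPointPackage (r : LatticeRep G) (a : ℝ → ℝ) : Prop :=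
  ∃ (Γ : ℝ → ℝ) (β₀ ℓ₀ c C : ℝ), 0 < ℓ₀ ∧ 0 < c ∧ (∀ β, 0 < a β) ∧
    Filter.Tendsto a Filter.atTop (nhds 0) ∧ (∀ s : ℝ, 0 < s → s ≤ ℓ₀ → 0 < Γ s ∧ Γ s ≤ 1) ∧
    ∀ (L : ℕ) [NeZero L] (β : ℝ), β₀ ≤ β → (L : ℝ) * a β ≤ ℓ₀ →
      (∀ n : ℕ, 1 ≤ n → 8 * n ≤ L →
        c * Γ ((n : ℝ) * a β) ≤ (n : ℝ) ^ 8 *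
            wCov r L β (plaq r L 0 0 1) (plaq r L (Pi.single (2 : Fin 4) ((n : ℕ) : ZMod L)) 0 1) ∧
        (n : ℝ) ^ 8 * wCov r L β (plaq r L 0 0 1) (plaq r L (Pi.single (2 : Fin 4) ((n : ℕ) : ZMod L)) 0 1) ≤
            C * Γ ((n : ℝ) * a β)) ∧
      (∀ (x y : Site 4 L) (i j i' j' : Fin 4), x ≠ y → i ≠ j → i' ≠ j' →
        |wCov r L β (plaq r L x i j) (plaq r L y i' j')| * torusDist L x y ^ 8 ≤
          C * Γ (torusDist L x y * a β))

/-- **Conclusion of the crux**: the skewness package for the unit map `a`. -/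
def SkewnessPackage (r : LatticeRep G) (a : ℝ → ℝ) : Prop :=
  ∃ (Γ₃ : ℝ → ℝ) (β₁ ℓ₁ c₃ : ℝ), 0 < ℓ₁ ∧ 0 < c₃ ∧ (∀ s : ℝ, 0 < s → s ≤ ℓ₁ → 0 < Γ₃ s) ∧
    ∀ (L : ℕ) [NeZero L] (β : ℝ), β₁ ≤ β → (L : ℝ) * a β ≤ ℓ₁ →
      ∀ n : ℕ, 1 ≤ n → 8 * n ≤ L → c₃ * Γ₃ ((n : ℝ) * a β) ≤ (n : ℝ) ^ 12 * |kappa3 r L β n|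

end Vocabulary

/-! ## §2 The exact zero at `β = 0` and the all-couplings strengthening -/

section BetaZero

variable {G : Type} [Group G] [TopologicalSpace G] [IsTopologicalGroup G] [CompactSpace G]
  [MeasurableSpace G] [BorelSpace G]

omit [TopologicalSpace G] [IsTopologicalGroup G] [CompactSpace G] [MeasurableSpace G] [BorelSpace G] in
/-- Edges with different base points differ. -/
theorem edge_ne_of_fst_ne {L : ℕ} {a b : Site 4 L} (i j : Fin 4) (h : a ≠ b) :
    ((a, i) : Edge 4 L) ≠ (b, j) := fun h' => h (Prod.ext_iff.1 h').1

omit [TopologicalSpace G] [IsTopologicalGroup G] [CompactSpace G] [MeasurableSpace G] [BorelSpace G] in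
/-- Edges with different directions differ. -/
theorem edge_ne_of_snd_ne {L : ℕ} (a b : Site 4 L) {i j : Fin 4} (h : i ≠ j) :
    ((a, i) : Edge 4 L) ≠ (b, j) := fun h' => h (Prod.ext_iff.1 h').2

/-- **Three-factor ultralocality**: if a continuous `F` does not see one bond `e` of the plaquette
`(z; k,l)`, then `∫ F · Φ(U_{z,kl}) dHaar^{⊗E} = (∫ F)(∫_G Φ)` (resample `e` first). -/
theorem integral_mul_plaquette_of_private [SecondCountableTopology G] (S : ℕ) [NeZero S]
    (hS : (1 : ZMod S) ≠ 0) {Φ : G → ℝ} (hΦ : Continuous Φ) {F : GaugeConfig 4 S G → ℝ}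
    (hF : Continuous F) (z : Site 4 S) {k l : Fin 4} (hkl : k ≠ l) {e : Edge 4 S}
    (he : e = (z, k) ∨ e = (z.shift k, l) ∨ e = (z.shift l, k) ∨ e = (z, l))
    (hFe : ∀ (U : GaugeConfig 4 S G) (g : G), F (Function.update U e g) = F U) :
    ∫ U, F U * Φ (plaquetteHolonomy U z k l) ∂piHaar S =
      (∫ U, F U ∂piHaar S) * ∫ g, Φ g ∂haarProbability G := by
  classical
  have hint : Integrable (fun U : GaugeConfig 4 S G => F U * Φ (plaquetteHolonomy U z k l)) (piHaar S) :=
    integrable_of_continuous S (hF.mul (hΦ.comp (continuous_plaquetteHolonomy S z k l)))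
  rw [piHaar, integral_pi_eq_integral_update (fun _ : Edge 4 S => haarProbability G) e hint]
  have hupd : ∀ U : GaugeConfig 4 S G,
      ∫ g, F (Function.update U e g) * Φ (plaquetteHolonomy (Function.update U e g) z k l)
          ∂haarProbability G =
        F U * ∫ g, Φ g ∂haarProbability G := fun U => by
    simp_rw [hFe U]
    rw [integral_const_mul, (integral_update_plaquette S hS hΦ z hkl U he).2]
  simp_rw [hupd]
  rw [integral_mul_const]

/-- **`β = 0` is an exact zero of the crux's cumulant**, on every torus with `L ≥ 2` and every
separation `n ≢ 0 (mod L)` (in particular for all admissible `1 ≤ n ≤ L/8`): under product Haar the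
plaquette at `n e₃` owns the bond `(n e₃, 0)`, which neither the plaquette at `0` nor the one at `n e₂` touches,
so all mixed moments factorise.  No simplicity of `G` is needed. -/
theorem kappa3_zero_coupling (r : LatticeRep G) (L : ℕ) [NeZero L] (hL : (1 : ZMod L) ≠ 0) (n : ℕ)
    (hn : ((n : ℕ) : ZMod L) ≠ 0) : kappa3 r L 0 n = 0 := by
  classical
  haveI : SecondCountableTopology G :=
    (r.continuous.isClosedEmbedding r.injective).isEmbedding.secondCountableTopology
  have hE : ∀ F : GaugeConfig 4 L G → ℝ, wE r L 0 F = ∫ U, F U ∂piHaar L := fun F => by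
    simp only [wE, wilsonExpectation, wilsonMeasure_zero]
  simp only [kappa3, wCov, hE]
  set y : Site 4 L := Pi.single (2 : Fin 4) ((n : ℕ) : ZMod L) with hy
  set z : Site 4 L := Pi.single (3 : Fin 4) ((n : ℕ) : ZMod L) with hz
  set Φ : G → ℝ := fun g => (r.N : ℝ) - (r.ρ g).trace.re with hΦdef
  have hΦ : Continuous Φ := continuous_const.sub (continuous_trace_re r.ρ r.continuous)
  have h01 : (0 : Fin 4) ≠ 1 := by decide
  -- geometry of the three base points
  have h0y : (0 : Site 4 L) ≠ y := fun h => hn (by simpa [hy] using (congrFun h 2).symm)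
  have h0z : (0 : Site 4 L) ≠ z := fun h => hn (by simpa [hz] using (congrFun h 3).symm)
  have hyz : y ≠ z := fun h => hn (by
    have := congrFun h 2
    simpa [hy, hz, Pi.single_apply] using this)
  have hz1 : z 1 = 0 := by simp [hz]
  have hy1 : y 1 = 0 := by simp [hy]
  -- the private bond `(z, 0)` of the third plaquette is not on the first two
  have hupd : ∀ (x : Site 4 L), x ≠ z → x 1 = 0 → ∀ (U : GaugeConfig 4 L G) (g : G),
      plaquetteHolonomy (Function.update U ((z, (0 : Fin 4)) : Edge 4 L) g) x 0 1 =
        plaquetteHolonomy U x 0 1 := by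
    intro x hxz hx1 U g
    refine plaquetteHolonomy_update_of_ne L x 0 1 U ?_ ?_ ?_ ?_ g
    · exact edge_ne_of_fst_ne 0 0 (Ne.symm hxz)
    · exact edge_ne_of_snd_ne _ _ h01
    · refine edge_ne_of_fst_ne 0 0 fun h => hL ?_
      have := congrFun h 1
      simpa [Site.shift, hz1, hx1] using this.symm
    · exact edge_ne_of_snd_ne _ _ h01
  -- one-, two- and three-point functions under product Haar
  have h1 : ∀ x : Site 4 L, ∫ U, plaq r L x 0 1 U ∂piHaar L = ∫ g, Φ g ∂haarProbability G :=
    fun x => integral_comp_plaquette L hL hΦ x h01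
  have h2 : ∀ x x' : Site 4 L, x ≠ x' →
      ∫ U, plaq r L x 0 1 U * plaq r L x' 0 1 U ∂piHaar L =
        (∫ g, Φ g ∂haarProbability G) * ∫ g, Φ g ∂haarProbability G :=
    fun x x' hxx' => integral_plaquette_mul_plaquette L hL hΦ hΦ hxx' h01 h01
  have hF : Continuous fun U : GaugeConfig 4 L G => plaq r L 0 0 1 U * plaq r L y 0 1 U :=
    (hΦ.comp (continuous_plaquetteHolonomy L 0 0 1)).mul (hΦ.comp (continuous_plaquetteHolonomy L y 0 1))
  have h3 : ∫ U, plaq r L 0 0 1 U * plaq r L y 0 1 U * plaq r L z 0 1 U ∂piHaar L =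
      (∫ g, Φ g ∂haarProbability G) * (∫ g, Φ g ∂haarProbability G) * ∫ g, Φ g ∂haarProbability G := by
    have key := integral_mul_plaquette_of_private L hL hΦ hF z h01 (e := (z, 0)) (Or.inl rfl)
      (fun U g => by
        show plaq r L 0 0 1 _ * plaq r L y 0 1 _ = _
        simp only [plaq, hupd 0 h0z (by simp) U g, hupd y hyz hy1 U g])
    rw [h2 0 y h0y] at key
    exact key
  rw [h3, h2 0 y h0y, h2 0 z h0z, h2 y z hyz, h1 0, h1 y, h1 z]
  ring

/-- NATURAL STRENGTHENING (all couplings, all volumes): the crux's lower bound with the weak-coupling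
threshold `β₁ ≤ β` replaced by `0 ≤ β` and the femto box `L·a(β) ≤ ℓ₁` dropped (Γ₃ positive on `(0,∞)`). -/
def SkewnessBoundAllCouplings (r : LatticeRep G) (a : ℝ → ℝ) : Prop :=
  ∃ (Γ₃ : ℝ → ℝ) (c₃ : ℝ), 0 < c₃ ∧ (∀ s : ℝ, 0 < s → 0 < Γ₃ s) ∧
    ∀ (L : ℕ) [NeZero L] (β : ℝ), 0 ≤ β → ∀ n : ℕ, 1 ≤ n → 8 * n ≤ L →
      c₃ * Γ₃ ((n : ℝ) * a β) ≤ (n : ℝ) ^ 12 * |kappa3 r L β n|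

/-- **The all-couplings strengthening is false for every `G`, `r` and every positive unit map**:
at `β = 0`, `L = 8`, `n = 1` the cumulant vanishes identically (`kappa3_zero_coupling`).
So the threshold `β₁` of the crux is load-bearing: any proof must use weak coupling. -/
theorem not_skewnessBoundAllCouplings (r : LatticeRep G) (a : ℝ → ℝ) (ha : ∀ β, 0 < a β) :
    ¬ SkewnessBoundAllCouplings r a := by
  rintro ⟨Γ₃, c₃, hc₃, hΓ₃, h⟩
  have h8 : kappa3 r 8 0 1 = 0 := kappa3_zero_coupling r 8 (by decide) 1 (by decide)
  have key := h 8 0 le_rfl 1 le_rfl (by norm_num)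
  rw [h8, abs_zero, mul_zero] at key
  have hpos : 0 < c₃ * Γ₃ (((1 : ℕ) : ℝ) * a 0) := mul_pos hc₃ (hΓ₃ _ (by simpa using ha 0))
  linarith

end BetaZero

/-! ## §3 Structure of the conclusion: level sets, eventual non-vanishing, kill criteria -/

section Structure

variable {G : Type} [Group G] [TopologicalSpace G] [IsTopologicalGroup G] [CompactSpace G]
  [MeasurableSpace G] [BorelSpace G]

/-- Admissible separations lie in the shape function's positivity window. -/
theorem level_mem_window {a : ℝ → ℝ} (ha : ∀ β, 0 < a β) {ℓ : ℝ} {L n : ℕ} {β : ℝ}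
    (hL : (L : ℝ) * a β ≤ ℓ) (hn : 1 ≤ n) (h8 : 8 * n ≤ L) :
    0 < (n : ℝ) * a β ∧ (n : ℝ) * a β ≤ ℓ := by
  have hn' : (1 : ℝ) ≤ n := by exact_mod_cast hn
  have h8' : (8 : ℝ) * n ≤ L := by exact_mod_cast h8
  refine ⟨mul_pos (by linarith) (ha β), le_trans ?_ hL⟩
  exact mul_le_mul_of_nonneg_right (by linarith) (ha β).le

/-- **The skewness package depends on `a` only through level sets.**  Because `Γ₃` is existential with
no upper bound, continuity or monotonicity, `SkewnessPackage r a` says exactly: for some `β₁, ℓ₁`, on every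
level set `{(L, β, n) admissible : n·a(β) = s}` (`0 < s ≤ ℓ₁`) the normalised cumulant `n¹²|κ₃|` is bounded
below by a positive constant `γ(s)`.  (For a generic STEP unit map each level set is one β-cell × finitely many
`(L,n)`, so the package is then equivalent to `κ₃ ≠ 0` on closed cells — zeros of `β ↦ κ₃` are the only enemy.) -/
theorem skewnessPackage_iff_levelwise (r : LatticeRep G) {a : ℝ → ℝ} (ha : ∀ β, 0 < a β) :
    SkewnessPackage r a ↔ ∃ β₁ ℓ₁ : ℝ, 0 < ℓ₁ ∧ ∀ s : ℝ, 0 < s → s ≤ ℓ₁ → ∃ γ : ℝ, 0 < γ ∧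
      ∀ (L : ℕ) [NeZero L] (β : ℝ) (n : ℕ), β₁ ≤ β → (L : ℝ) * a β ≤ ℓ₁ → 1 ≤ n → 8 * n ≤ L →
        (n : ℝ) * a β = s → γ ≤ (n : ℝ) ^ 12 * |kappa3 r L β n| := by
  constructor
  · rintro ⟨Γ₃, β₁, ℓ₁, c₃, hℓ₁, hc₃, hΓ₃, h⟩
    refine ⟨β₁, ℓ₁, hℓ₁, fun s hs hsℓ => ⟨c₃ * Γ₃ s, mul_pos hc₃ (hΓ₃ s hs hsℓ), ?_⟩⟩
    intro L _ β n hβ hL hn h8 hs'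
    have key := h L β hβ hL n hn h8
    rwa [hs'] at key
  · rintro ⟨β₁, ℓ₁, hℓ₁, h⟩
    classical
    choose! γ hγpos hγ using h
    refine ⟨γ, β₁, ℓ₁, 1, hℓ₁, one_pos, hγpos, ?_⟩
    intro L _ β hβ hL n hn h8
    obtain ⟨hs, hsℓ⟩ := level_mem_window ha hL hn h8
    rw [one_mul]
    exact hγ _ hs hsℓ L β n hβ hL hn h8 rfl

/-- **Fixed-torus eventual non-vanishing.**  For ANY unit map (`a > 0`, `a → 0`) the skewness package forces,
on every fixed torus `L ≥ 8n`, `κ₃(L, β, n) ≠ 0` for all sufficiently large `β` — the admissible couplings of a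
fixed torus always contain a neighbourhood of `+∞`.  (This is a statement about the semiclassical/toron
expansion at FIXED `L`; it is the part of the crux no choice of `a` can weaken.) -/
theorem eventually_kappa3_ne_zero (r : LatticeRep G) {a : ℝ → ℝ} (ha : ∀ β, 0 < a β)
    (ha0 : Tendsto a atTop (𝓝 0)) (h : SkewnessPackage r a) (L : ℕ) [NeZero L] (n : ℕ)
    (hn : 1 ≤ n) (h8 : 8 * n ≤ L) : ∀ᶠ β in atTop, kappa3 r L β n ≠ 0 := by
  obtain ⟨Γ₃, β₁, ℓ₁, c₃, hℓ₁, hc₃, hΓ₃, hb⟩ := h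
  have hLpos : (0 : ℝ) < L := by
    have h8' : (8 : ℝ) * n ≤ L := by exact_mod_cast h8
    have hn' : (1 : ℝ) ≤ n := by exact_mod_cast hn
    linarith
  have hev : ∀ᶠ β in atTop, a β ∈ Set.Iio (ℓ₁ / L) :=
    ha0.eventually_mem (Iio_mem_nhds (div_pos hℓ₁ hLpos))
  filter_upwards [hev, eventually_ge_atTop β₁] with β hβ hβ₁
  have hLa : (L : ℝ) * a β ≤ ℓ₁ := by
    have hlt : a β < ℓ₁ / L := hβ
    rw [lt_div_iff₀ hLpos] at hlt
    linarith [mul_comm (a β) (L : ℝ)]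
  obtain ⟨hs, hsℓ⟩ := level_mem_window ha hLa hn h8
  have key := hb L β hβ₁ hLa n hn h8
  intro h0
  rw [h0, abs_zero, mul_zero] at key
  exact absurd key (not_le.2 (mul_pos hc₃ (hΓ₃ _ hs hsℓ)))

/-- **The sign-change mechanism** (formal shape of finding 3): a continuous `β ↦ κ₃(L,β,n)` that is `≤ 0`
at `b₁` and `≥ 0` at `b₂ ≥ b₁` has an exact zero in `[b₁, b₂]`; if that interval is admissible the bound fails
there.  UV sign `+` (tree level); an IR sign `−` would force such zeros. -/
theorem zero_of_sign_change (r : LatticeRep G) (L : ℕ) [NeZero L] (n : ℕ) {b₁ b₂ : ℝ} (hb : b₁ ≤ b₂)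
    (hcont : ContinuousOn (fun β => kappa3 r L β n) (Set.Icc b₁ b₂))
    (h₁ : kappa3 r L b₁ n ≤ 0) (h₂ : 0 ≤ kappa3 r L b₂ n) :
    ∃ β ∈ Set.Icc b₁ b₂, kappa3 r L β n = 0 :=
  intermediate_value_Icc hb hcont ⟨h₁, h₂⟩

end Structure




end Summit.QuantumFields.YangMills.Theorems.FemtoCurvatureSkewness.Negative
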